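import Mathlib.Analysis.InnerProductSpace.LinearMap

/-!
# Rotating-wave character from two measured defects (solo soloist, blind mode, s9)

Numerical linear-stability computations about a steady Navier–Stokes state `ū` that is fixed by a
finite symmetry group `G` return a leading complex eigenvector `v = a + i b` together with two
scalars: `rot_defect = ‖R a − a‖ / ‖a‖` for the order-three generator `R ∈ G` and the residual of
`v` against its best multiple under `R`.  The paper (`steady-zeroth-law.md`, §13.3 (j)) infers from
`rot_defect = √3` (to 17 digits) that `R` acts on the eigenplane by the primitive character
`ω = e^{± 2πi/3}`.  This file is the kernel-checked form of the two implications used there, for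
any real linear isometry `R` of a real inner-product space:

* `rotDefect_of_omega_action`: if `R a = -a/2 - (√3/2) b` and `R b = (√3/2) a - b/2`
  (i.e. `R v = ω v` on `v = a + i b`), then `‖a‖ = ‖b‖`, `⟪a, b⟫ = 0` and `‖R a - a‖² = 3‖a‖²`
  (so `rot_defect = √3` exactly, and `t ↦ Re (e^{iθt} v)` is a ROTATING WAVE: advancing the phase by
  `2π/3` is applying `R`).
* `rotDefect_of_fixed`: if `R a = a` then `‖R a - a‖ = 0` (the trivial character gives defect `0`),

so a measured defect of `√3` separates the two real-type alternatives for an element of order 3.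
Pure inner-product-space algebra; no fluid mechanics is used.
-/

open scoped InnerProductSpace
open RealInnerProductSpace

namespace Summit.AnomalousDissipation.AnomalousDissipation.Theorems

variable {E : Type*} [NormedAddCommGroup E] [InnerProductSpace ℝ E]

/-- If a real linear isometry acts on the real plane spanned by `a, b` as multiplication by
`ω = e^{2πi/3}` on `a + ib`, then `a ⊥ b`, `‖a‖ = ‖b‖`, and `‖R a - a‖ ^ 2 = 3 ‖a‖ ^ 2`. -/
theorem rotDefect_of_omega_action (R : E →ₗᵢ[ℝ] E) (a b : E)
    (ha : R a = (-(1/2 : ℝ)) • a - (Real.sqrt 3 / 2) • b)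
    (hb : R b = (Real.sqrt 3 / 2) • a - (1/2 : ℝ) • b) :
    ‖a‖ = ‖b‖ ∧ ⟪a, b⟫_ℝ = 0 ∧ ‖R a - a‖ ^ 2 = 3 * ‖a‖ ^ 2 := by
  have h3 : Real.sqrt 3 * Real.sqrt 3 = 3 := Real.mul_self_sqrt (by norm_num)
  -- the three isometry identities, expanded in the basis quantities
  have n1 : ‖R a‖ ^ 2 = ‖a‖ ^ 2 := by rw [R.norm_map]
  have n2 : ‖R b‖ ^ 2 = ‖b‖ ^ 2 := by rw [R.norm_map]
  have n3 : ⟪R a, R b⟫_ℝ = ⟪a, b⟫_ℝ := R.inner_map_map a b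
  rw [ha] at n1 n3
  rw [hb] at n2 n3
  have iba : ⟪b, a⟫_ℝ = ⟪a, b⟫_ℝ := real_inner_comm a b
  -- expand squared norms and inner products of the linear combinations
  have e1 : ‖(-(1/2 : ℝ)) • a - (Real.sqrt 3 / 2) • b‖ ^ 2
      = (1/4) * ‖a‖ ^ 2 + (3/4) * ‖b‖ ^ 2 + (Real.sqrt 3 / 2) * ⟪a, b⟫_ℝ := by
    rw [@norm_sub_sq_real, norm_smul, norm_smul, real_inner_smul_left, real_inner_smul_right]
    rw [Real.norm_eq_abs, Real.norm_eq_abs, abs_of_nonpos (by norm_num : (-(1/2:ℝ)) ≤ 0),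
      abs_of_nonneg (by positivity : (0:ℝ) ≤ Real.sqrt 3 / 2)]
    ring_nf
    nlinarith [h3, sq_nonneg ‖b‖]
  have e2 : ‖(Real.sqrt 3 / 2) • a - (1/2 : ℝ) • b‖ ^ 2
      = (3/4) * ‖a‖ ^ 2 + (1/4) * ‖b‖ ^ 2 - (Real.sqrt 3 / 2) * ⟪a, b⟫_ℝ := by
    rw [@norm_sub_sq_real, norm_smul, norm_smul, real_inner_smul_left, real_inner_smul_right]
    rw [Real.norm_eq_abs, Real.norm_eq_abs, abs_of_nonneg (by positivity : (0:ℝ) ≤ Real.sqrt 3 / 2),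
      abs_of_nonneg (by norm_num : (0:ℝ) ≤ 1/2)]
    ring_nf
    nlinarith [h3, sq_nonneg ‖a‖]
  have e3 : ⟪(-(1/2 : ℝ)) • a - (Real.sqrt 3 / 2) • b, (Real.sqrt 3 / 2) • a - (1/2 : ℝ) • b⟫_ℝ
      = -(Real.sqrt 3 / 4) * ‖a‖ ^ 2 + (Real.sqrt 3 / 4) * ‖b‖ ^ 2 - (1/2) * ⟪a, b⟫_ℝ := by
    rw [inner_sub_left, inner_sub_right, inner_sub_right]
    simp only [real_inner_smul_left, real_inner_smul_right, real_inner_self_eq_norm_sq, iba]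
    linear_combination (-(1/4 : ℝ) * ⟪a, b⟫_ℝ) * h3
  rw [e1] at n1
  rw [e2] at n2
  rw [e3] at n3
  -- solve the linear system for D = ‖a‖² - ‖b‖² and P = ⟪a,b⟫
  have hs : (0:ℝ) < Real.sqrt 3 := Real.sqrt_pos.mpr (by norm_num)
  have hP : ⟪a, b⟫_ℝ = 0 := by nlinarith [n1, n2, n3, h3, hs]
  have hD : ‖a‖ ^ 2 = ‖b‖ ^ 2 := by nlinarith [n1, n2, n3, h3, hs, hP]
  refine ⟨?_, hP, ?_⟩
  · exact (pow_left_inj₀ (norm_nonneg a) (norm_nonneg b) two_ne_zero).mp hD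
  · have e4 : R a - a = (-(3/2 : ℝ)) • a - (Real.sqrt 3 / 2) • b := by
      rw [ha]; module
    rw [e4, @norm_sub_sq_real, norm_smul, norm_smul, real_inner_smul_left, real_inner_smul_right,
      Real.norm_eq_abs, Real.norm_eq_abs, abs_of_nonpos (by norm_num : (-(3/2:ℝ)) ≤ 0),
      abs_of_nonneg (by positivity : (0:ℝ) ≤ Real.sqrt 3 / 2), hP]
    ring_nf
    nlinarith [h3, hD]

/-- The conjugate character `ω̄ = e^{-2πi/3}` (`R v = ω̄ v` on `v = a + ib`) gives the same three
conclusions (apply the previous lemma to `(a, -b)`). -/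
theorem rotDefect_of_omegaBar_action (R : E →ₗᵢ[ℝ] E) (a b : E)
    (ha : R a = (-(1/2 : ℝ)) • a + (Real.sqrt 3 / 2) • b)
    (hb : R b = (-(Real.sqrt 3 / 2)) • a - (1/2 : ℝ) • b) :
    ‖a‖ = ‖b‖ ∧ ⟪a, b⟫_ℝ = 0 ∧ ‖R a - a‖ ^ 2 = 3 * ‖a‖ ^ 2 := by
  have ha' : R a = (-(1/2 : ℝ)) • a - (Real.sqrt 3 / 2) • (-b) := by rw [ha]; module
  have hb' : R (-b) = (Real.sqrt 3 / 2) • a - (1/2 : ℝ) • (-b) := by rw [map_neg, hb]; module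
  obtain ⟨h1, h2, h3⟩ := rotDefect_of_omega_action R a (-b) ha' hb'
  refine ⟨by rwa [norm_neg] at h1, ?_, h3⟩
  rwa [inner_neg_right, neg_eq_zero] at h2

/-- The trivial character gives defect zero. -/
theorem rotDefect_of_fixed (R : E →ₗᵢ[ℝ] E) (a : E) (ha : R a = a) : ‖R a - a‖ = 0 := by
  rw [ha, sub_self, norm_zero]

/-- Conversely to `rotDefect_of_omega_action`, for an isometry with `R (R (R a)) = a` ... we only
record the dichotomy actually used: an `R`-fixed vector cannot have defect `√3 ‖a‖` unless `a = 0`. -/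
theorem eq_zero_of_fixed_of_rotDefect (R : E →ₗᵢ[ℝ] E) (a : E) (ha : R a = a)
    (hd : ‖R a - a‖ ^ 2 = 3 * ‖a‖ ^ 2) : a = 0 := by
  rw [ha, sub_self, norm_zero] at hd
  have : ‖a‖ ^ 2 = 0 := by nlinarith [hd]
  exact norm_eq_zero.mp (pow_eq_zero_iff (two_ne_zero) |>.mp this)

end Summit.AnomalousDissipation.AnomalousDissipation.Theorems
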